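/-
Copyright (c) 2026 the pub-hodgecm-mathlib formalisation cell (harness21).  Prover seat hodgecm-mathlib-LH4-p04 (g7), req620 Track A «(D-RAM) FOUR-FRAME» squad
(β₂ lane, dealer∕pen LH4-plan (g13) WORDs #90∕#94∕#100; `SIG-beta2S.v1` ca422439 sub-brick (S-1)), 2026-09-04.
-/
import Literature.NumberTheory.Automorphic.UnitaryLatticeTreeBlockGlueFibreCount   -- ★ `ncard_glueFibre_eq_natCard_normFibre` (the fibre set `Sol_{2b}(r)` whose letters this file reuses)
import HarnessLib

/-!
# Crux `H413`, line LH4 «(D-RAM) FOUR-FRAME» — β₂ lane, (S-1): «FULL-FIBRE TRANSPORT» — the norm-residue fibres `Sol_{2b}(r)` and `Sol_{2b}(r′)` are in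
# bijection under `x ↦ x·z₁` whenever a unit `z₁` with `z₁·σz₁·r ≡ r′ (mod ϖ^{2b})` exists

Cell `hodgecm-mathlib` (D-0151), FLOOR 0, crux item H413 = `stmt-HodgeConjecture-24833`; lane `--supports stmt-HodgeConjecture-24833 --as helper` (count-neutral).
THEOREMS ONLY, Mathlib-only letters (no `def`, no instance, no notation, no `sorry`).  The set is LITERALLY the right-hand side of ★ `ncard_glueFibre_eq_natCard_normFibre`
(`Literature/…/UnitaryLatticeTreeBlockGlueFibreCount`): `Sol_{2b}(r) := {x : 𝒪[K] ⧸ 𝓂[K]^{2b} // ∃ u, mk u = x ∧ |u·σu − r| ≤ |ϖ^{2b}|}`.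
USE (`SIG-beta2S.v1` §2): on a GENERIC cone cell the two literals `t_h`, `t_a` of a type-(2) class have glue fibres `Sol_{2b}(r_h)`, `Sol_{2b}(r_a)` over the SAME plane
lattice `Λ`; below the conductor a unit `z₁` with `N(z₁) ≡ r_a∕r_h` exists (★ `WildQuadraticDatumNormSurjective`, cited by name downstream, not re-proved here), and this
file's bijection is the carrier of the label transport (S-2).  HONEST LABEL: residue-ring algebra; β₂ remains a HYPOTHESIS of the T₊ chain until (β₂-S)+(β₂-H)+(S4) are ★;
`HC_CM` is proved only modulo the 7 printed citations (2 remaining named inputs: hLiu418 = `stmt-HodgeConjecture-24832`, h413 = `stmt-HodgeConjecture-24833`) until rung 0 closes.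
## References
* [Jacobowitz1962] R. Jacobowitz, *Hermitian forms over local fields*, Amer. J. Math. 84 (1962): §4 (norm residues and gluing).
* [Serre1979] J.-P. Serre, *Local Fields*, GTM 67 (1979): Ch. V §2 (norm groups of the unit filtration).
-/

set_option autoImplicit false

noncomputable section
namespace Summit.HodgeConjecture.HodgeConjecture.Cruxes.H413.F0P3cDyRamNormFibreTransport

open scoped Valued WithZero

variable {K : Type*} [Field K] [Valued K ℤᵐ⁰]

/-- Ultrametric transport of the norm congruence: if `|u σu − r| ≤ |m|`, `|z₁| = |σ z₁| = 1` and `|z₁ σz₁ r − r′| ≤ |m|`, then `|(u z₁) σ(u z₁) − r′| ≤ |m|`.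
[cite: Jacobowitz1962, §4] -/
theorem v_mul_norm_sub_le (σ : K →+* K) {u z₁ r r' m : K} (hz₁ : Valued.v z₁ = 1) (hσz₁ : Valued.v (σ z₁) = 1)
    (hu : Valued.v (u * σ u - r) ≤ Valued.v m) (hz : Valued.v (z₁ * σ z₁ * r - r') ≤ Valued.v m) :
    Valued.v ((u * z₁) * σ (u * z₁) - r') ≤ Valued.v m := by
  have e : (u * z₁) * σ (u * z₁) - r' = (u * σ u - r) * (z₁ * σ z₁) + (z₁ * σ z₁ * r - r') := by rw [map_mul]; ring
  rw [e]
  refine Valuation.map_add_le _ ?_ hz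
  rw [map_mul, map_mul, hz₁, hσz₁, mul_one, mul_one]
  exact hu

/-- **(S-1) FULL-FIBRE TRANSPORT.**  For a unit `z₁ ∈ 𝒪[K]` (`|z₁| = |σz₁| = 1`) with `|z₁·σz₁·r − r′| ≤ |ϖ^{2b}|`, right multiplication by `z₁` is a bijection
`Sol_{2b}(r) ≃ Sol_{2b}(r′)` of the norm-residue fibres of ★ `ncard_glueFibre_eq_natCard_normFibre`; in particular they have the same cardinality.
[cite: Jacobowitz1962, §4] [cite: Serre1979, Ch. V §2] -/
theorem natCard_normFibre_eq_of_unit (σ : K →+* K) {ϖ : K} (b : ℕ) {r r' : K} {z₁ : 𝒪[K]}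
    (hz₁ : Valued.v (z₁ : K) = 1) (hσz₁ : Valued.v (σ (z₁ : K)) = 1)
    (hz : Valued.v ((z₁ : K) * σ (z₁ : K) * r - r') ≤ Valued.v (ϖ ^ (2 * b))) :
    Nat.card {x : 𝒪[K] ⧸ 𝓂[K] ^ (2 * b) // ∃ u : 𝒪[K], Ideal.Quotient.mk (𝓂[K] ^ (2 * b)) u = x ∧
        Valued.v ((u : K) * σ u - r) ≤ Valued.v (ϖ ^ (2 * b))} =
      Nat.card {x : 𝒪[K] ⧸ 𝓂[K] ^ (2 * b) // ∃ u : 𝒪[K], Ideal.Quotient.mk (𝓂[K] ^ (2 * b)) u = x ∧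
        Valued.v ((u : K) * σ u - r') ≤ Valued.v (ϖ ^ (2 * b))} := by
  classical
  -- `z₁` is a unit of `𝒪[K]`
  have hz₁0 : IsUnit ((algebraMap 𝒪[K] K) z₁) := isUnit_iff_ne_zero.2 (by
    intro h0
    have : Valued.v (z₁ : K) = 0 := by rw [show (z₁ : K) = (algebraMap 𝒪[K] K) z₁ from rfl, h0, map_zero]
    rw [this] at hz₁; exact zero_ne_one hz₁)
  have hz₁U : IsUnit z₁ := Valuation.Integers.isUnit_of_one (Valuation.integer.integers (Valued.v : Valuation K ℤᵐ⁰)) hz₁0 hz₁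
  obtain ⟨w, hw⟩ := hz₁U
  -- the inverse unit transports `r′` back to `r`
  have hwinv1 : Valued.v ((↑(w⁻¹ : (𝒪[K])ˣ) : 𝒪[K]) : K) = 1 := by
    have h1 : ((↑(w⁻¹ : (𝒪[K])ˣ) : 𝒪[K]) : K) * (z₁ : K) = 1 := by
      rw [← hw, ← Subring.coe_mul, Units.inv_mul, Subring.coe_one]
    have := congrArg Valued.v h1
    rw [map_mul, hz₁, mul_one, map_one] at this
    exact this
  have hσwinv1 : Valued.v (σ (((↑(w⁻¹ : (𝒪[K])ˣ) : 𝒪[K]) : K))) = 1 := by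
    have h1 : σ (((↑(w⁻¹ : (𝒪[K])ˣ) : 𝒪[K]) : K)) * σ (z₁ : K) = 1 := by
      rw [← map_mul, ← hw, ← Subring.coe_mul, Units.inv_mul, Subring.coe_one, map_one]
    have := congrArg Valued.v h1
    rw [map_mul, hσz₁, mul_one, map_one] at this
    exact this
  have hzinv : Valued.v ((((↑(w⁻¹ : (𝒪[K])ˣ) : 𝒪[K]) : K)) * σ (((↑(w⁻¹ : (𝒪[K])ˣ) : 𝒪[K]) : K)) * r' - r) ≤ Valued.v (ϖ ^ (2 * b)) := by
    set y : K := ((↑(w⁻¹ : (𝒪[K])ˣ) : 𝒪[K]) : K) with hy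
    have hyz : y * (z₁ : K) = 1 := by rw [hy, ← hw, ← Subring.coe_mul, Units.inv_mul, Subring.coe_one]
    have hσyz : σ y * σ (z₁ : K) = 1 := by rw [← map_mul, hyz, map_one]
    have e : y * σ y * r' - r = -(y * σ y) * ((z₁ : K) * σ (z₁ : K) * r - r') := by
      have : y * σ y * ((z₁ : K) * σ (z₁ : K)) = 1 := by
        calc y * σ y * ((z₁ : K) * σ (z₁ : K)) = (y * (z₁ : K)) * (σ y * σ (z₁ : K)) := by ring
          _ = 1 := by rw [hyz, hσyz, mul_one]
      calc y * σ y * r' - r = y * σ y * r' - (y * σ y * ((z₁ : K) * σ (z₁ : K))) * r := by rw [this, one_mul]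
        _ = -(y * σ y) * ((z₁ : K) * σ (z₁ : K) * r - r') := by ring
    rw [e, map_mul, Valuation.map_neg, map_mul, hwinv1, hσwinv1, one_mul, one_mul]
    exact hz
  -- the two maps
  refine Nat.card_congr
    { toFun := fun x => ⟨x.1 * Ideal.Quotient.mk (𝓂[K] ^ (2 * b)) z₁, ?_⟩
      invFun := fun x => ⟨x.1 * Ideal.Quotient.mk (𝓂[K] ^ (2 * b)) (↑(w⁻¹ : (𝒪[K])ˣ) : 𝒪[K]), ?_⟩
      left_inv := fun x => ?_
      right_inv := fun x => ?_ }
  · obtain ⟨u, hu, hur⟩ := x.2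
    refine ⟨u * z₁, by rw [map_mul, hu], ?_⟩
    rw [Subring.coe_mul]
    exact v_mul_norm_sub_le σ hz₁ hσz₁ hur hz
  · obtain ⟨u, hu, hur⟩ := x.2
    refine ⟨u * (↑(w⁻¹ : (𝒪[K])ˣ) : 𝒪[K]), by rw [map_mul, hu], ?_⟩
    rw [Subring.coe_mul]
    exact v_mul_norm_sub_le σ hwinv1 hσwinv1 hur hzinv
  · apply Subtype.ext
    show x.1 * _ * _ = x.1
    rw [mul_assoc, ← map_mul, ← hw, ← Units.val_mul, mul_inv_cancel, Units.val_one, map_one, mul_one]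
  · apply Subtype.ext
    show x.1 * _ * _ = x.1
    rw [mul_assoc, ← map_mul, ← hw, ← Units.val_mul, inv_mul_cancel, Units.val_one, map_one, mul_one]

end Summit.HodgeConjecture.HodgeConjecture.Cruxes.H413.F0P3cDyRamNormFibreTransport

end
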